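import Summits.ValiantsHypothesis.ValiantsHypothesis.Theorems.BarrierLeverChowBenchmarkPairsSplit

/-!
# Route BarrierLever — item 22038 `ChowBenchmarkPairs`, line `moore-peel`: the PURE SPLIT STEP in final form
# (heights `0` off `I`, `x^{ρ(v)}` on `I`): «inside nonsingular» ∧ «touching, reweighted, nonsingular» ⇒ «whole nonsingular»

Helper file (`--supports stmt-ValiantsHypothesis-22038`; cell valiant-natproofs, rung V4; seat val-np-p4 gen 23).  Closes NO item.

This is the split constructor of THEOREM PS («pure-splittable families are Haar», memo HOME/val-np-p4/g23/ §8) as ONE kernel statement.  Data: a table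
`P : π → κ → R`, a coordinate `c`, a vertex set `I` with ranks `ρ`, rows of two kinds — INSIDE rows `(S₁ i, w₁ i)` with `S₁ i ∩ I = ∅` on `c`-free columns
`T₁ j`, and TOUCHING rows `(S₂ i, w₂ i)` each with a unique `ρ`-minimal vertex `y i ∈ S₂ i ∩ I`, on columns `T₂ j + c` (`c ∉ T₂ j`).  The SPLIT TABLE
replaces coordinate `c` by the heights `x^{ρ(a)}` on `I` and `0` off `I` (`splitTable`).  Then (`det_split_table_ne_zero`, `split_step[_finite]`): if
`det[dirE P (S₁ i) (w₁ i) (T₁ j)] ≠ 0` and `det[dirE P (S₂ i) (w₂ i + δ_{y i}) (T₂ j)] ≠ 0` (the REWEIGHTED touching family) and the weights `w₂ i (y i)` are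
nonzero in `R`, the whole matrix at the split table is nonsingular for all but finitely many `x`: it is block triangular (`det_fromBlocks_split`: inside rows
vanish on the `c`-columns) and the `c`-block's lowest term in `x` is `x^{Σρ(y i)} ∏ w₂ i (y i) · det(reweighted)` (only points of `I` carry heights, and `y i` is
strictly dominant among them).

WHAT THIS IS NOT: no stub of the line is closed; nothing on crux stmt-ValiantsHypothesis-14610 or on `VP` versus `VNP`.
-/

set_option linter.dupNamespace false

namespace Summit.ValiantsHypothesis.ValiantsHypothesis.Theorems.BarrierLever.ChowBenchmarkSplit

open Finset Polynomial

variable {κ : Type*} [DecidableEq κ] {R : Type*} [CommRing R] {π : Type*} [DecidableEq π]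

/-! ## 1. The split table -/

/-- The symbolic split table: coordinate `c` carries `X^{ρ a}` at the points of `I` and `0` elsewhere; other coordinates are the constants of `P`. -/
noncomputable def splitTableX (P : π → κ → R) (c : κ) (I : Finset π) (ρ : π → ℕ) : π → κ → R[X] :=
  fun a c' => if c' = c then (if a ∈ I then X ^ ρ a else 0) else C (P a c')

/-- The split table at a scalar `x`. -/
def splitTable (P : π → κ → R) (c : κ) (I : Finset π) (ρ : π → ℕ) (x : R) : π → κ → R :=
  fun a c' => if c' = c then (if a ∈ I then x ^ ρ a else 0) else P a c'

/-- `c`-free columns do not see the heights. -/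
theorem dirE_splitTableX_of_not_mem (P : π → κ → R) (c : κ) (I : Finset π) (ρ : π → ℕ) (S : Finset π) (w : π → ℕ)
    {T : Finset κ} (hc : c ∉ T) : dirE (splitTableX P c I ρ) S w T = C (dirE P S w T) := by
  rw [map_dirE C]
  exact dirE_congr S w fun a c' hc' => by
    have : c' ≠ c := fun e => hc (e ▸ hc')
    simp [splitTableX, this]

/-- Inside rows (disjoint from `I`) vanish on the `c`-columns. -/
theorem dirE_splitTableX_inside (P : π → κ → R) (c : κ) (I : Finset π) (ρ : π → ℕ) (S : Finset π) (w : π → ℕ)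
    (hS : ∀ a ∈ S, a ∉ I) {T : Finset κ} (hc : c ∈ T) : dirE (splitTableX P c I ρ) S w T = 0 :=
  dirE_eq_zero_of_mem _ S w T hc fun a ha => by simp [splitTableX, hS a ha]

/-- Touching rows on a `c`-column: `Σ_{a ∈ S ∩ I} w_a X^{ρ a} · C(dirE P S (w+δ_a) T')`. -/
theorem dirE_splitTableX_insert (P : π → κ → R) (c : κ) (I : Finset π) (ρ : π → ℕ) (S : Finset π) (w : π → ℕ)
    {T' : Finset κ} (hc : c ∉ T') :
    dirE (splitTableX P c I ρ) S w (insert c T') =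
      ∑ a : ↥S, (w a : R[X]) * (if (a : π) ∈ I then X ^ ρ a else 0) *
        C (dirE P S (Function.update w (a : π) (w a + 1)) T') := by
  rw [dirE_insert S _ _ hc]
  refine Finset.sum_congr rfl fun a _ => ?_
  rw [show splitTableX P c I ρ a c = (if (a : π) ∈ I then X ^ ρ a else 0) by simp [splitTableX],
    dirE_splitTableX_of_not_mem _ _ _ _ _ _ hc]

/-! ## 2. The `c`-block: leading term -/

/-- The reduced `c`-block entry of a touching row with dominant vertex `y` (`ρ y ≤ ρ a` on `S ∩ I`). -/
noncomputable def redEntryI (P : π → κ → R) (I : Finset π) (ρ : π → ℕ) (S : Finset π) (w : π → ℕ) (y : π) (T' : Finset κ) : R[X] :=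
  ∑ a : ↥S, (w a : R[X]) * (if (a : π) ∈ I then X ^ (ρ a - ρ y) else 0) *
    C (dirE P S (Function.update w (a : π) (w a + 1)) T')

/-- Factoring the dominant height out of a touching row. -/
theorem dirE_splitTableX_eq_mul_redEntryI (P : π → κ → R) (c : κ) (I : Finset π) (ρ : π → ℕ) (S : Finset π) (w : π → ℕ)
    (y : π) (hy : ∀ a ∈ S, a ∈ I → ρ y ≤ ρ a) {T' : Finset κ} (hc : c ∉ T') :
    dirE (splitTableX P c I ρ) S w (insert c T') = X ^ ρ y * redEntryI P I ρ S w y T' := by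
  rw [dirE_splitTableX_insert P c I ρ S w hc, redEntryI, Finset.mul_sum]
  refine Finset.sum_congr rfl fun a _ => ?_
  by_cases haI : (a : π) ∈ I
  · rw [if_pos haI, if_pos haI]
    have hsplit : (X : R[X]) ^ ρ a = X ^ (ρ a - ρ y) * X ^ ρ y := by
      rw [← pow_add, Nat.sub_add_cancel (hy a a.2 haI)]
    rw [hsplit]
    ring
  · rw [if_neg haI, if_neg haI]
    ring

/-- At `X = 0` only the dominant vertex survives: `redEntryI(0) = w_y · dirE P S (w+δ_y) T'` when `y ∈ S ∩ I` is STRICTLY `ρ`-minimal on `S ∩ I`. -/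
theorem eval_zero_redEntryI (P : π → κ → R) (I : Finset π) (ρ : π → ℕ) (S : Finset π) (w : π → ℕ) (y : π) (hyS : y ∈ S)
    (hyI : y ∈ I) (hdom : ∀ a ∈ S, a ∈ I → a ≠ y → ρ y < ρ a) (T' : Finset κ) :
    (redEntryI P I ρ S w y T').eval 0 = (w y : R) * dirE P S (Function.update w y (w y + 1)) T' := by
  rw [redEntryI, eval_finsetSum, Finset.sum_eq_single (⟨y, hyS⟩ : ↥S)]
  · simp [hyI]
  · intro a _ ha
    have hne : (a : π) ≠ y := fun e => ha (Subtype.ext e)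
    by_cases haI : (a : π) ∈ I
    · have hpos : 0 < ρ a - ρ y := Nat.sub_pos_of_lt (hdom a a.2 haI hne)
      simp [haI, zero_pow (Nat.pos_iff_ne_zero.mp hpos)]
    · simp [haI]
  · intro h
    exact absurd (Finset.mem_univ _) h

section Det

variable [IsDomain R] {ι₁ ι₂ : Type*} [Fintype ι₁] [Fintype ι₂] [DecidableEq ι₁] [DecidableEq ι₂]

/-- **The `c`-block at the split table is a nonzero polynomial** when the reweighted touching family is nonsingular at `P` and the dominant
weights are nonzero. -/
theorem det_cBlock_splitTableX_ne_zero (P : π → κ → R) (c : κ) (I : Finset π) (ρ : π → ℕ)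
    (S₂ : ι₂ → Finset π) (w₂ : ι₂ → π → ℕ) (y : ι₂ → π) (hyS : ∀ i, y i ∈ S₂ i) (hyI : ∀ i, y i ∈ I)
    (hdom : ∀ i, ∀ a ∈ S₂ i, a ∈ I → a ≠ y i → ρ (y i) < ρ a) (hw : ∀ i, (w₂ i (y i) : R) ≠ 0)
    (T₂ : ι₂ → Finset κ) (hc : ∀ j, c ∉ T₂ j)
    (hdet : (Matrix.of fun i j : ι₂ => dirE P (S₂ i) (Function.update (w₂ i) (y i) (w₂ i (y i) + 1)) (T₂ j)).det ≠ 0) :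
    (Matrix.of fun i j : ι₂ => dirE (splitTableX P c I ρ) (S₂ i) (w₂ i) (insert c (T₂ j))).det ≠ 0 := by
  classical
  set N : Matrix ι₂ ι₂ R[X] := Matrix.of fun i j => redEntryI P I ρ (S₂ i) (w₂ i) (y i) (T₂ j) with hN
  have hfac : (Matrix.of fun i j : ι₂ => dirE (splitTableX P c I ρ) (S₂ i) (w₂ i) (insert c (T₂ j))) =
      Matrix.of fun i j => (fun i => (X : R[X]) ^ ρ (y i)) i * N i j := by
    refine Matrix.ext fun i j => ?_
    rw [Matrix.of_apply, Matrix.of_apply, hN, Matrix.of_apply]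
    exact dirE_splitTableX_eq_mul_redEntryI P c I ρ (S₂ i) (w₂ i) (y i)
      (fun a ha haI => by
        by_cases e : a = y i
        · rw [e]
        · exact le_of_lt (hdom i a ha haI e)) (hc j)
  rw [hfac, Matrix.det_mul_column]
  refine mul_ne_zero (Finset.prod_ne_zero_iff.mpr fun i _ => pow_ne_zero _ Polynomial.X_ne_zero) ?_
  intro h0
  have h1 : (N.det).eval 0 = 0 := by rw [h0, eval_zero]
  have h2 : (N.det).eval 0 = (Matrix.of fun i j : ι₂ => (redEntryI P I ρ (S₂ i) (w₂ i) (y i) (T₂ j)).eval 0).det := by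
    have := RingHom.map_det (Polynomial.evalRingHom (0 : R)) N
    rw [Polynomial.coe_evalRingHom] at this
    rw [this]
    congr 1
  have h3 : (Matrix.of fun i j : ι₂ => (redEntryI P I ρ (S₂ i) (w₂ i) (y i) (T₂ j)).eval 0) =
      Matrix.of fun i j : ι₂ => (fun i => (w₂ i (y i) : R)) i *
        (Matrix.of fun i j : ι₂ => dirE P (S₂ i) (Function.update (w₂ i) (y i) (w₂ i (y i) + 1)) (T₂ j)) i j := by
    ext i j
    rw [Matrix.of_apply, Matrix.of_apply, Matrix.of_apply, eval_zero_redEntryI P I ρ (S₂ i) (w₂ i) (y i) (hyS i) (hyI i) (hdom i)]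
  rw [h2, h3, Matrix.det_mul_column] at h1
  exact (mul_ne_zero (Finset.prod_ne_zero_iff.mpr fun i _ => hw i) hdet) h1

/-- The whole matrix at the symbolic split table: rows `ι₁ ⊕ ι₂` (inside, touching), columns `ι₁ ⊕ ι₂` (`c`-free `T₁`, `c`-columns `T₂ + c`). -/
noncomputable def splitMatrixX (P : π → κ → R) (c : κ) (I : Finset π) (ρ : π → ℕ)
    (S₁ : ι₁ → Finset π) (w₁ : ι₁ → π → ℕ) (S₂ : ι₂ → Finset π) (w₂ : ι₂ → π → ℕ)
    (T₁ : ι₁ → Finset κ) (T₂ : ι₂ → Finset κ) : Matrix (ι₁ ⊕ ι₂) (ι₁ ⊕ ι₂) R[X] :=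
  Matrix.of fun i j => dirE (splitTableX P c I ρ) (Sum.elim S₁ S₂ i) (Sum.elim w₁ w₂ i) (Sum.elim T₁ (fun j => insert c (T₂ j)) j)

/-- **THE PURE SPLIT STEP (symbolic).**  Inside rows nonsingular on the `c`-free columns at `P`, touching rows (reweighted at their strictly dominant
vertex in `I`) nonsingular on the stripped `c`-columns at `P`, dominant weights nonzero ⇒ the whole matrix at the symbolic split table has nonzero determinant. -/
theorem det_splitMatrixX_ne_zero (P : π → κ → R) (c : κ) (I : Finset π) (ρ : π → ℕ)
    (S₁ : ι₁ → Finset π) (w₁ : ι₁ → π → ℕ) (S₂ : ι₂ → Finset π) (w₂ : ι₂ → π → ℕ)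
    (T₁ : ι₁ → Finset κ) (T₂ : ι₂ → Finset κ) (hT₁ : ∀ j, c ∉ T₁ j) (hT₂ : ∀ j, c ∉ T₂ j)
    (hS₁ : ∀ i, ∀ a ∈ S₁ i, a ∉ I)
    (y : ι₂ → π) (hyS : ∀ i, y i ∈ S₂ i) (hyI : ∀ i, y i ∈ I)
    (hdom : ∀ i, ∀ a ∈ S₂ i, a ∈ I → a ≠ y i → ρ (y i) < ρ a) (hw : ∀ i, (w₂ i (y i) : R) ≠ 0)
    (hin : (Matrix.of fun i j : ι₁ => dirE P (S₁ i) (w₁ i) (T₁ j)).det ≠ 0)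
    (htouch : (Matrix.of fun i j : ι₂ => dirE P (S₂ i) (Function.update (w₂ i) (y i) (w₂ i (y i) + 1)) (T₂ j)).det ≠ 0) :
    (splitMatrixX P c I ρ S₁ w₁ S₂ w₂ T₁ T₂).det ≠ 0 := by
  classical
  have hblocks : splitMatrixX P c I ρ S₁ w₁ S₂ w₂ T₁ T₂ =
      Matrix.fromBlocks (Matrix.of fun i j => dirE (splitTableX P c I ρ) (S₁ i) (w₁ i) (T₁ j))
        (Matrix.of fun i j => dirE (splitTableX P c I ρ) (S₁ i) (w₁ i) (insert c (T₂ j)))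
        (Matrix.of fun i j => dirE (splitTableX P c I ρ) (S₂ i) (w₂ i) (T₁ j))
        (Matrix.of fun i j => dirE (splitTableX P c I ρ) (S₂ i) (w₂ i) (insert c (T₂ j))) := by
    ext i j
    rcases i with i | i <;> rcases j with j | j <;> rfl
  rw [hblocks, det_fromBlocks_split (splitTableX P c I ρ) S₁ w₁ S₂ w₂ T₁ (fun j => insert c (T₂ j)) c
    (fun j => Finset.mem_insert_self c (T₂ j)) (fun i a ha => by simp [splitTableX, hS₁ i a ha])]
  refine mul_ne_zero ?_ (det_cBlock_splitTableX_ne_zero P c I ρ S₂ w₂ y hyS hyI hdom hw T₂ hT₂ htouch)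
  -- the inside block is the constant matrix `C (old)`
  have e : (Matrix.of fun i j : ι₁ => dirE (splitTableX P c I ρ) (S₁ i) (w₁ i) (T₁ j)) =
      (Polynomial.C : R →+* R[X]).mapMatrix (Matrix.of fun i j : ι₁ => dirE P (S₁ i) (w₁ i) (T₁ j)) := by
    refine Matrix.ext fun i j => ?_
    rw [RingHom.mapMatrix_apply, Matrix.map_apply, Matrix.of_apply, Matrix.of_apply, dirE_splitTableX_of_not_mem _ _ _ _ _ _ (hT₁ j)]
  rw [e, ← RingHom.map_det]
  intro h0
  apply hin
  exact Polynomial.C_injective (by rw [h0, map_zero])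

omit [IsDomain R] in
/-- Evaluating the symbolic split matrix at `x` gives the matrix of the split table `splitTable P c I ρ x`. -/
theorem eval_det_splitMatrixX (P : π → κ → R) (c : κ) (I : Finset π) (ρ : π → ℕ)
    (S₁ : ι₁ → Finset π) (w₁ : ι₁ → π → ℕ) (S₂ : ι₂ → Finset π) (w₂ : ι₂ → π → ℕ)
    (T₁ : ι₁ → Finset κ) (T₂ : ι₂ → Finset κ) (x : R) :
    (splitMatrixX P c I ρ S₁ w₁ S₂ w₂ T₁ T₂).det.eval x = (Matrix.of fun i j : ι₁ ⊕ ι₂ =>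
      dirE (splitTable P c I ρ x) (Sum.elim S₁ S₂ i) (Sum.elim w₁ w₂ i) (Sum.elim T₁ (fun j => insert c (T₂ j)) j)).det := by
  classical
  have h1 : (Polynomial.evalRingHom x) (splitMatrixX P c I ρ S₁ w₁ S₂ w₂ T₁ T₂).det =
      ((Polynomial.evalRingHom x).mapMatrix (splitMatrixX P c I ρ S₁ w₁ S₂ w₂ T₁ T₂)).det := RingHom.map_det _ _
  rw [Polynomial.coe_evalRingHom] at h1
  rw [h1]
  congr 1
  ext i j
  rw [RingHom.mapMatrix_apply, Matrix.map_apply, splitMatrixX, Matrix.of_apply, Matrix.of_apply, Polynomial.coe_evalRingHom,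
    ← Polynomial.coe_evalRingHom, map_dirE]
  congr 1
  funext a c'
  by_cases e : c' = c
  · subst e
    by_cases ha : a ∈ I <;> simp [splitTableX, splitTable, ha]
  · simp [splitTableX, splitTable, e]

/-- **THE PURE SPLIT STEP, cofinite form**: all but finitely many height scalars `x` make the whole matrix at the split table nonsingular. -/
theorem split_step_finite (P : π → κ → R) (c : κ) (I : Finset π) (ρ : π → ℕ)
    (S₁ : ι₁ → Finset π) (w₁ : ι₁ → π → ℕ) (S₂ : ι₂ → Finset π) (w₂ : ι₂ → π → ℕ)
    (T₁ : ι₁ → Finset κ) (T₂ : ι₂ → Finset κ) (hT₁ : ∀ j, c ∉ T₁ j) (hT₂ : ∀ j, c ∉ T₂ j)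
    (hS₁ : ∀ i, ∀ a ∈ S₁ i, a ∉ I)
    (y : ι₂ → π) (hyS : ∀ i, y i ∈ S₂ i) (hyI : ∀ i, y i ∈ I)
    (hdom : ∀ i, ∀ a ∈ S₂ i, a ∈ I → a ≠ y i → ρ (y i) < ρ a) (hw : ∀ i, (w₂ i (y i) : R) ≠ 0)
    (hin : (Matrix.of fun i j : ι₁ => dirE P (S₁ i) (w₁ i) (T₁ j)).det ≠ 0)
    (htouch : (Matrix.of fun i j : ι₂ => dirE P (S₂ i) (Function.update (w₂ i) (y i) (w₂ i (y i) + 1)) (T₂ j)).det ≠ 0) :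
    Set.Finite {x : R | (Matrix.of fun i j : ι₁ ⊕ ι₂ =>
      dirE (splitTable P c I ρ x) (Sum.elim S₁ S₂ i) (Sum.elim w₁ w₂ i) (Sum.elim T₁ (fun j => insert c (T₂ j)) j)).det = 0} := by
  have hne := det_splitMatrixX_ne_zero P c I ρ S₁ w₁ S₂ w₂ T₁ T₂ hT₁ hT₂ hS₁ y hyS hyI hdom hw hin htouch
  refine (Polynomial.finite_setOf_isRoot hne).subset fun x hx => ?_
  rw [Set.mem_setOf_eq, Polynomial.IsRoot.def, eval_det_splitMatrixX]
  exact hx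

/-- **THE PURE SPLIT STEP** (over an infinite domain, e.g. `ℂ`): some height scalar works. -/
theorem split_step [Infinite R] (P : π → κ → R) (c : κ) (I : Finset π) (ρ : π → ℕ)
    (S₁ : ι₁ → Finset π) (w₁ : ι₁ → π → ℕ) (S₂ : ι₂ → Finset π) (w₂ : ι₂ → π → ℕ)
    (T₁ : ι₁ → Finset κ) (T₂ : ι₂ → Finset κ) (hT₁ : ∀ j, c ∉ T₁ j) (hT₂ : ∀ j, c ∉ T₂ j)
    (hS₁ : ∀ i, ∀ a ∈ S₁ i, a ∉ I)
    (y : ι₂ → π) (hyS : ∀ i, y i ∈ S₂ i) (hyI : ∀ i, y i ∈ I)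
    (hdom : ∀ i, ∀ a ∈ S₂ i, a ∈ I → a ≠ y i → ρ (y i) < ρ a) (hw : ∀ i, (w₂ i (y i) : R) ≠ 0)
    (hin : (Matrix.of fun i j : ι₁ => dirE P (S₁ i) (w₁ i) (T₁ j)).det ≠ 0)
    (htouch : (Matrix.of fun i j : ι₂ => dirE P (S₂ i) (Function.update (w₂ i) (y i) (w₂ i (y i) + 1)) (T₂ j)).det ≠ 0) :
    ∃ x : R, (Matrix.of fun i j : ι₁ ⊕ ι₂ =>
      dirE (splitTable P c I ρ x) (Sum.elim S₁ S₂ i) (Sum.elim w₁ w₂ i) (Sum.elim T₁ (fun j => insert c (T₂ j)) j)).det ≠ 0 := by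
  obtain ⟨x, hx⟩ := Set.Infinite.nonempty (Set.Finite.infinite_compl
    (split_step_finite P c I ρ S₁ w₁ S₂ w₂ T₁ T₂ hT₁ hT₂ hS₁ y hyS hyI hdom hw hin htouch))
  exact ⟨x, hx⟩

end Det

end Summit.ValiantsHypothesis.ValiantsHypothesis.Theorems.BarrierLever.ChowBenchmarkSplit
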